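import Summits.QuantumAdvantage.QuantumAdvantage.Theorems.RankDialL1
import HarnessLib

/-!
# RankDial (L2) — §30 the junta-rank layer beneath `BlockPiece`: `BlockJSpan` (η = 1 PROVED), `BlockJSpread`, `r5_residual_block`, `block_dial`, `closes_block`

TARGET BY NAME (cell decomp-qadv, RESIDUAL MODE): item stmt-QuantumAdvantage-23109
`Summit.QuantumAdvantage.QuantumAdvantage.Theses.OddPrimeWalk.ManyReadersSqrtOdd`, through rung R5 = `AdviceFreeQNC0.WalkHardFLinSel p`.
This file SUPPORTS the item (`--supports`); it does not close it.  Declaration bodies are byte-identical to the cell node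
«BlockDial» (decomp-qadv lens-1, generation 27, part L; node file RankDialL.lean), cut into ≤ 400-line parts
L1 (§28 `WindowClassBias`; §29 `SepBlock`, `BlockPiece`, `ClusteredPiece`, `WindowPiece`, `R5 ⟺ BlockPiece ∧ ClusteredPiece`, `η = 1` recovery;
imports tree RankDialK2 + RankDialJ1) → L2 (§30 `BlockJSpan`, `BlockJSpread`, `blockPiece_of_jspan_jspread`, `r5_residual_block`, `block_dial`,
`closes_block`, `target_iff_block`; imports L1) and L3 (§31 multi-liveness: `card_filter_le_two_thirds`, `deadCount`, `WinLabel`, `multiLiveness`;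
pure counting, imports tree RankDialK2 only — independent of L1/L2).  See the node file for the mechanism summary and the tags.
-/

set_option linter.dupNamespace false
set_option autoImplicit false

noncomputable section
open Classical

namespace Summit.QuantumAdvantage.QuantumAdvantage.Theorems.RankDial

open Finset
open Summit.QuantumAdvantage.AdviceFreeQNC0
open Literature.Computability.MetaComplexity Literature.Computability.MetaComplexity.Smolensky

/-! ### §30 (part L «BlockDial») The junta-rank layer beneath `BlockPiece` and the frame `closes_block` -/

section BlockLayer
variable (p : ℕ) [Fact p.Prime]

/-- **PIECE `BlockJSpan p η`** (the perturb law for separated blocks): for every width `s`, one `θ < 1` and a budget `M` such that a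
linear-test strategy with an `η`-separated block of junta-rank `≤ D` (`JRankLE p y lam s D`, part K) and `(p·D+2)·M ≤ ℓ` wins on
`≤ θ·2ⁿ`.  [NECESSARY (`blockJSpan_of_r5`) · `η = 1`: `↔ WindowJSpanLinSel p`, PROVED for `p ≠ 3` (`blockJSpan_one_holds`) ·
`η ≥ 2`: ATTACKABLE — §31's multi-liveness + the class-sum machinery of parts C–K on blocks whose inside gaps are `≥ ℓ/η`.] -/
def BlockJSpan (η : ℕ) : Prop :=
  ∀ s : ℕ, ∃ θ : ℝ, θ < 1 ∧ ∃ M : ℕ, ∀ L ℓ R : ℕ,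
    ∀ (c : ℕ) (y : Fin (L + ℓ + R + 1) → (Fin (L + ℓ + R) → Bool) → Bool)
      (lam : Fin (L + ℓ + R + 1) → Fin (L + ℓ + R) → ZMod p) (rr : Fin (L + ℓ + R + 1) → ZMod p),
      (∀ g u, y g u = decide ((∑ i, if u i then lam g i else 0) = rr g)) → SepBlock y L ℓ η →
      ∀ D : ℕ, JRankLE p y lam s D → (p * D + 2) * M ≤ ℓ →
      ((univ.filter fun u : Fin (L + ℓ + R) → Bool => ringWinU c y u = true).card : ℝ) ≤ θ * (2 : ℝ) ^ (L + ℓ + R)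

/-- **PIECE `BlockJSpread p η s`** (the residual of the analytic side): the block law for long `η`-separated blocks of junta-rank
`> ℓ/E`.  [NECESSARY (`blockJSpread_of_r5`) · `η = 1`: `↔ WindowJSpreadLinSel p s` (`blockJSpread_one_iff`) · IDEA-NEEDED: the
average-case two-prime depth-2 problem of §28, now for blocks.] -/
def BlockJSpread (η s : ℕ) : Prop :=
  ∀ E : ℕ, 0 < E → ∃ θ : ℝ, θ < 1 ∧ ∃ C : ℕ, ∃ n₀ : ℕ, ∀ L ℓ R : ℕ, n₀ ≤ L + ℓ + R →
    C * (Nat.log 2 (L + ℓ + R) + 1) ≤ ℓ →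
    ∀ (c : ℕ) (y : Fin (L + ℓ + R + 1) → (Fin (L + ℓ + R) → Bool) → Bool)
      (lam : Fin (L + ℓ + R + 1) → Fin (L + ℓ + R) → ZMod p) (rr : Fin (L + ℓ + R + 1) → ZMod p),
      (∀ g u, y g u = decide ((∑ i, if u i then lam g i else 0) = rr g)) → SepBlock y L ℓ η →
      ¬ JRankLE p y lam s (ℓ / E) →
      ((univ.filter fun u : Fin (L + ℓ + R) → Bool => ringWinU c y u = true).card : ℝ) ≤ θ * (2 : ℝ) ^ (L + ℓ + R)

/-- `η = 1`: the block perturb law IS the window perturb law of part K. -/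
theorem blockJSpan_one_iff : BlockJSpan p 1 ↔ WindowJSpanLinSel p := by
  constructor
  · intro h s
    obtain ⟨θ, hθ, M, h⟩ := h s
    exact ⟨θ, hθ, M, fun L ℓ R c y lam rr hyl hgap D hJ hℓ =>
      h L ℓ R c y lam rr hyl ((sepBlock_one_iff y L ℓ).mpr hgap) D hJ hℓ⟩
  · intro h s
    obtain ⟨θ, hθ, M, h⟩ := h s
    exact ⟨θ, hθ, M, fun L ℓ R c y lam rr hyl hsep D hJ hℓ =>
      h L ℓ R c y lam rr hyl ((sepBlock_one_iff y L ℓ).mp hsep) D hJ hℓ⟩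

/-- **`BlockJSpan p 1` is a THEOREM** (`p ≠ 3`; part K's `windowJSpanLinSel_holds`). -/
theorem blockJSpan_one_holds (hp3 : p ≠ 3) : BlockJSpan p 1 :=
  (blockJSpan_one_iff p).mpr (windowJSpanLinSel_holds p hp3)

/-- `η = 1`: the block residual IS the window residual of part K. -/
theorem blockJSpread_one_iff (s : ℕ) : BlockJSpread p 1 s ↔ WindowJSpreadLinSel p s := by
  constructor
  · intro h E hE
    obtain ⟨θ, hθ, C, n₀, h⟩ := h E hE
    exact ⟨θ, hθ, C, n₀, fun L ℓ R hn hC c y lam rr hyl hgap hJ =>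
      h L ℓ R hn hC c y lam rr hyl ((sepBlock_one_iff y L ℓ).mpr hgap) hJ⟩
  · intro h E hE
    obtain ⟨θ, hθ, C, n₀, h⟩ := h E hE
    exact ⟨θ, hθ, C, n₀, fun L ℓ R hn hC c y lam rr hyl hsep hJ =>
      h L ℓ R hn hC c y lam rr hyl ((sepBlock_one_iff y L ℓ).mp hsep) hJ⟩

/-- NECESSITY: R5 implies the block perturb law. -/
theorem blockJSpan_of_r5 (η : ℕ) (h : WalkHardFLinSel p) : BlockJSpan p η := by
  intro s
  obtain ⟨θ, hθ, n₀, h⟩ := h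
  refine ⟨θ, hθ, n₀, fun L ℓ R c y lam rr hyl _ D _ hℓ => ?_⟩
  have h2 : 2 * n₀ ≤ (p * D + 2) * n₀ := Nat.mul_le_mul_right _ (by omega)
  have hn : n₀ ≤ L + ℓ + R := by omega
  exact h (L + ℓ + R) hn c y fun g => ⟨lam g, rr g, hyl g⟩

/-- NECESSITY: R5 implies the block residual. -/
theorem blockJSpread_of_r5 (η s : ℕ) (h : WalkHardFLinSel p) : BlockJSpread p η s := by
  intro E _
  obtain ⟨θ, hθ, n₀, h⟩ := h
  exact ⟨θ, hθ, 0, n₀, fun L ℓ R hn _ c y lam rr hyl _ _ => h (L + ℓ + R) hn c y fun g => ⟨lam g, rr g, hyl g⟩⟩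

/-- The block perturb law is ANTITONE in `η ≥ 1`. -/
theorem blockJSpan_anti {η η' : ℕ} (hη : 0 < η) (hle : η ≤ η') (h : BlockJSpan p η') : BlockJSpan p η := by
  intro s
  obtain ⟨θ, hθ, M, h⟩ := h s
  exact ⟨θ, hθ, M, fun L ℓ R c y lam rr hyl hsep D hJ hℓ =>
    h L ℓ R c y lam rr hyl (sepBlock_mono y hη hle hsep) D hJ hℓ⟩

/-- The block residual is ANTITONE in `η ≥ 1`. -/
theorem blockJSpread_anti {η η' : ℕ} (s : ℕ) (hη : 0 < η) (hle : η ≤ η') (h : BlockJSpread p η' s) :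
    BlockJSpread p η s := by
  intro E hE
  obtain ⟨θ, hθ, C, n₀, h⟩ := h E hE
  exact ⟨θ, hθ, C, n₀, fun L ℓ R hn hC c y lam rr hyl hsep hJ =>
    h L ℓ R hn hC c y lam rr hyl (sepBlock_mono y hη hle hsep) hJ⟩

/-- **`BlockPiece p η ⟸ BlockJSpan p η ∧ BlockJSpread p η s`** (the budget bookkeeping of `highRank_of_jspan_jspread`, part K,
with `SepBlock` for `CutFree`): split at junta-rank `ℓ/E'`, `E' = 3·p·(M+1)`. -/
theorem blockPiece_of_jspan_jspread (η s : ℕ) (hSp : BlockJSpan p η) (hSd : BlockJSpread p η s) : BlockPiece p η := by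
  have hp1 : 1 ≤ p := (Fact.out : p.Prime).one_lt.le
  obtain ⟨θ₁, hθ₁, M, hSp⟩ := hSp s
  set E' := 3 * (p * (M + 1)) with hE'
  have hE'pos : 0 < E' := by positivity
  obtain ⟨θ₂, hθ₂, C₂, n₂, hSd⟩ := hSd E' hE'pos
  refine ⟨max θ₁ θ₂, max_lt hθ₁ hθ₂, max C₂ (3 * (M + 1)), n₂, fun L ℓ R hn hCle c y hy hsep => ?_⟩
  have hlog : 1 ≤ Nat.log 2 (L + ℓ + R) + 1 := Nat.le_add_left 1 _
  have hC₂ : C₂ * (Nat.log 2 (L + ℓ + R) + 1) ≤ ℓ :=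
    le_trans (Nat.mul_le_mul_right _ (le_max_left C₂ _)) hCle
  have h3M : 3 * (M + 1) ≤ ℓ :=
    le_trans (le_trans (le_max_right C₂ _) (Nat.le_mul_of_pos_right _ hlog)) hCle
  have hpos : (0 : ℝ) ≤ (2 : ℝ) ^ (L + ℓ + R) := by positivity
  choose lam rr hyl using hy
  by_cases hJ : JRankLE p y lam s (ℓ / E')
  · set q := ℓ / (3 * (p * (M + 1))) with hq
    have hqmul : q * (3 * (p * (M + 1))) ≤ ℓ := Nat.div_mul_le_self ℓ _
    have hA : 3 * (p * q * M) ≤ ℓ := by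
      have h1 : 3 * (p * q * M) ≤ q * (3 * (p * (M + 1))) := by nlinarith
      omega
    have hbudget : (p * (ℓ / E') + 2) * M ≤ ℓ := by
      have h2 : (p * q + 2) * M = p * q * M + 2 * M := by ring
      have h3 : ℓ / E' = q := rfl
      rw [h3]
      omega
    exact le_trans (hSp L ℓ R c y lam rr hyl hsep _ hJ hbudget)
      (mul_le_mul_of_nonneg_right (le_max_left θ₁ θ₂) hpos)
  · exact le_trans (hSd L ℓ R hn hC₂ c y lam rr hyl hsep hJ) (mul_le_mul_of_nonneg_right (le_max_right θ₁ θ₂) hpos)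

/-- **FRAME OF PART L**: `BlockJSpan p η → BlockJSpread p η s → ClusteredPiece p η → WalkHardFLinSel p` (every `η`, `s`). -/
theorem r5_residual_block (η s : ℕ) (hSp : BlockJSpan p η) (hSd : BlockJSpread p η s) (hC : ClusteredPiece p η) :
    WalkHardFLinSel p :=
  r5_of_block_pieces p η (blockPiece_of_jspan_jspread p η s hSp hSd) hC

/-- NECESSITY of the whole frame: R5 ⟺ the three block pieces (every `η`, `s`). -/
theorem r5_iff_block_layer (η s : ℕ) :
    WalkHardFLinSel p ↔ (BlockJSpan p η ∧ BlockJSpread p η s ∧ ClusteredPiece p η) :=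
  ⟨fun h => ⟨blockJSpan_of_r5 p η h, blockJSpread_of_r5 p η s h, clusteredPiece_of_r5 p η h⟩,
    fun h => r5_residual_block p η s h.1 h.2.1 h.2.2⟩

/-- **At `η = 1` the frame IS the g26 residual** (`p ≥ 5`): `BlockJSpread p 1 s → ClusteredPiece p 1 → WalkHardFLinSel p`, i.e.
`r5_residual_jspread` read through `blockJSpread_one_iff` / `clusteredPiece_one_iff`. -/
theorem r5_residual_block_one (hp : 5 ≤ p) (s : ℕ) (hSd : BlockJSpread p 1 s) (hC : ClusteredPiece p 1) :
    WalkHardFLinSel p :=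
  r5_residual_block p 1 s (blockJSpan_one_holds p (by omega)) hSd hC

/-- **THE BLOCK DIAL** (summary, `p ≥ 5`, any `η ≥ 1`, any `s`): the analytic pieces only get HARDER and the core only gets EASIER
as `η` grows, the notch `η = 1` is the g26 residual, and every notch decides R5. -/
theorem block_dial (hp : 5 ≤ p) {η : ℕ} (hη : 1 ≤ η) (s : ℕ) :
    (WalkHardFLinSel p ↔ (BlockJSpan p η ∧ BlockJSpread p η s ∧ ClusteredPiece p η)) ∧
    (BlockJSpread p η s → WindowJSpreadLinSel p s) ∧ (NoWindowLinSel p → ClusteredPiece p η) ∧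
    (BlockJSpread p 1 s ↔ WindowJSpreadLinSel p s) ∧ (ClusteredPiece p 1 ↔ NoWindowLinSel p) ∧ BlockJSpan p 1 :=
  ⟨r5_iff_block_layer p η s,
    fun h => (blockJSpread_one_iff p s).mp (blockJSpread_anti p s Nat.one_pos hη h),
    clusteredPiece_of_noWindow p hη, blockJSpread_one_iff p s, clusteredPiece_one_iff p,
    blockJSpan_one_holds p (by omega)⟩

end BlockLayer

/-- **`closes_block`** — the target BY NAME from the three block pieces at any notch `(η, s)` and the declared residual `R5LiftOdd`
(part C): `(∀ p ≥ 5, BlockJSpan p η) → (∀ p ≥ 5, BlockJSpread p η s) → (∀ p ≥ 5, ClusteredPiece p η) → R5LiftOdd → Target`. -/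
theorem closes_block (η s : ℕ)
    (h₁ : ∀ (p : ℕ) [Fact p.Prime], 5 ≤ p → BlockJSpan p η)
    (h₂ : ∀ (p : ℕ) [Fact p.Prime], 5 ≤ p → BlockJSpread p η s)
    (h₃ : ∀ (p : ℕ) [Fact p.Prime], 5 ≤ p → ClusteredPiece p η)
    (h₄ : R5LiftOdd) : Theses.OddPrimeWalk.ManyReadersSqrtOdd :=
  h₄ fun p _ hp => r5_residual_block p η s (h₁ p hp) (h₂ p hp) (h₃ p hp)

/-- The target ⟺ the three block pieces at every odd prime `≥ 5` plus the lift (any notch `(η, s)`). -/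
theorem target_iff_block (η s : ℕ) :
    Theses.OddPrimeWalk.ManyReadersSqrtOdd ↔
      ((∀ (p : ℕ) [Fact p.Prime], 5 ≤ p → BlockJSpan p η) ∧ (∀ (p : ℕ) [Fact p.Prime], 5 ≤ p → BlockJSpread p η s) ∧
        (∀ (p : ℕ) [Fact p.Prime], 5 ≤ p → ClusteredPiece p η) ∧ R5LiftOdd) := by
  constructor
  · intro hT
    have h5 : ∀ (p : ℕ) [Fact p.Prime], 5 ≤ p → WalkHardFLinSel p := fun p _ hp => r5Odd_of_target hT p hp
    exact ⟨fun p _ hp => blockJSpan_of_r5 p η (h5 p hp), fun p _ hp => blockJSpread_of_r5 p η s (h5 p hp),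
      fun p _ hp => clusteredPiece_of_r5 p η (h5 p hp), r5LiftOdd_of_target hT⟩
  · rintro ⟨h₁, h₂, h₃, h₄⟩
    exact closes_block η s h₁ h₂ h₃ h₄

end Summit.QuantumAdvantage.QuantumAdvantage.Theorems.RankDial
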